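import Mathlib
import Literature.AlgebraicGeometry.Resolution.NeronPopescuSingularIdeal
import HarnessLib

/-!
# FieldTargets — PT for a field target `F → L` from generic formal smoothness
# (crux `IndSmooth.ValuativeSmoothing`, stmt-ResolutionOfSingularities-16087, line `birth`;
# lead c1 devissage programme "discrete jumps", stub B
# `hasSmoothFactorizations_field_of_formallySmooth`)

Let `F ⊆ L` be fields. We prove `HasSmoothFactorizations F L` ("PT holds for `F → L`",
`Literature.AlgebraicGeometry.Resolution.HasSmoothFactorizations`, Stacks Tag 07F2 in the
factorisation form of Tag 07C3 (2)): every `F`-algebra map `φ : A → L` with `A` of finite type over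
`F` factors through a smooth `F`-algebra — under the hypothesis that `Frac(B)` is formally smooth
over `F` for every finitely generated `F`-subalgebra `B ⊆ L` (the formal-smoothness form of
separability of `L/F`, Stacks Tag 0322; in the devissage it is produced by the neighbour stub
`formallySmooth_fractionRing_of_valuation`). This is the separable half of Stacks Tag 07BV
("`K/k` separable ⇒ `K` is a filtered colimit of smooth `k`-algebras"), proved as there via
Tag 037X / Tag 07ND and the pointwise notion of smoothness of Tag 00TB (smooth at `𝔮` iff
`S_g` is smooth for some `g ∉ 𝔮`; Mathlib's `Algebra.IsSmoothAt.exists_notMem_smooth`):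

* replace `A` by its image `B = φ(A) ⊆ L`, a finitely generated — hence finitely presented, `F`
  being Noetherian (`Algebra.FinitePresentation.of_finiteType`) — domain over `F`;
* `B_{(0)} = Frac(B)` (both are `B` localised at its nonzero elements, `Ideal.primeCompl_bot`), so
  the hypothesis says `F → B` is smooth at the generic point `⊥` in Mathlib's sense
  `Algebra.IsSmoothAt` (`hasSmoothFactorizations_field_isSmoothAt_bot_iff`);
* openness of the smooth locus of a finitely presented algebra
  (`Algebra.IsSmoothAt.exists_notMem_smooth`) gives `f ∈ B`, `f ≠ 0`, with `B_f` smooth over `F`;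
* `f` is invertible in the field `L`, so `B → L` extends to `B_f → L` (`IsLocalization.liftAlgHom`)
  and `φ = (A ↠ B → B_f → L)` factors through the smooth `F`-algebra `B_f`
  (`hasSmoothFactorizations_field_factorsThroughSmooth_of_smooth_away`).

Design notes. The two helpers are stated in the generality in which they are reusable: the first
for any domain over any commutative ring, the second for any `φ : A → Λ` of commutative rings and
any `f ∈ φ(A)` that is a unit in `Λ` (universe-polymorphic, matching `FactorsThroughSmooth`). The
`F`-algebra structures on `Frac(B)`, `B_{(0)}` and `B_f` are the composite ones through `B`
(`Localization` instances), as in the registered signature.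
-/

-- single-problem summit: the doubled namespace component is forced
set_option linter.dupNamespace false

open scoped TensorProduct

universe u

namespace Summit.ResolutionOfSingularities.ResolutionOfSingularities.Theorems.ValuativeSmoothing

open Literature.AlgebraicGeometry.Resolution

/-- For a domain `B` over a commutative ring `R`, smoothness of `R → B` at the generic point
`⊥` (Mathlib: formal smoothness of `R → B_{(0)}`) is formal smoothness of `R → Frac(B)`: both
`B_{(0)}` and `Frac(B)` are the localisation of `B` at its nonzero elements
(`Ideal.primeCompl_bot`), whence an `R`-algebra isomorphism `B_{(0)} ≃ Frac(B)`
(`IsLocalization.algEquiv`). This is the translation between the separability hypothesis of the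
stub (formal smoothness of the fraction field, Stacks Tag 0322) and "smooth at `(0)`" (Stacks
Tag 07ND, Tag 00TB). [folklore] -/
theorem hasSmoothFactorizations_field_isSmoothAt_bot_iff (R B : Type*) [CommRing R]
    [CommRing B] [IsDomain B] [Algebra R B] :
    Algebra.IsSmoothAt R (⊥ : Ideal B) ↔ Algebra.FormallySmooth R (FractionRing B) := by
  haveI : IsLocalization (nonZeroDivisors B) (Localization.AtPrime (⊥ : Ideal B)) := by
    simpa [Ideal.primeCompl_bot] using
      Localization.isLocalization (M := (⊥ : Ideal B).primeCompl)
  exact Algebra.FormallySmooth.iff_of_equiv ((IsLocalization.algEquiv (nonZeroDivisors B)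
    (Localization.AtPrime (⊥ : Ideal B)) (FractionRing B)).restrictScalars R)

/-- If the image `B = φ(A) ⊆ Λ` of an `R`-algebra map `φ : A → Λ` contains an element `f` that
is a unit of `Λ` and for which `B_f` is smooth over `R`, then `φ` factors through the smooth
`R`-algebra `B_f`, as `A ↠ B → B_f → Λ`, the last map being the localisation lift of the
inclusion `B ⊆ Λ` (`IsLocalization.liftAlgHom`). [folklore] -/
theorem hasSmoothFactorizations_field_factorsThroughSmooth_of_smooth_away {R A Λ : Type u}
    [CommRing R] [CommRing A] [Algebra R A] [CommRing Λ] [Algebra R Λ] (φ : A →ₐ[R] Λ)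
    (f : φ.range) (hf : IsUnit (f : Λ)) (hs : Algebra.Smooth R (Localization.Away f)) :
    FactorsThroughSmooth R φ := by
  have hunit : ∀ y : Submonoid.powers f, IsUnit (φ.range.val y) := by
    rintro ⟨y, n, rfl⟩
    simpa using hf.pow n
  refine ⟨Localization.Away f, inferInstance, inferInstance, hs,
    (IsScalarTower.toAlgHom R φ.range (Localization.Away f)).comp φ.rangeRestrict,
    IsLocalization.liftAlgHom (M := Submonoid.powers f) (f := φ.range.val) hunit, ?_⟩
  ext a
  simp [IsLocalization.lift_eq]

/-- Stub B: PT for a field target from generic formal smoothness of f.g. subalgebras.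

For fields `F ⊆ L`: if `Frac(B)` is formally smooth over `F` for every finitely generated
`F`-subalgebra `B ⊆ L`, then every `F`-algebra map `φ : A → L` with `A` of finite type over `F`
factors through a smooth `F`-algebra (`HasSmoothFactorizations F L`). Proof: `B = φ(A)` is a
finitely presented domain over `F`, smooth at `(0)` by hypothesis
(`hasSmoothFactorizations_field_isSmoothAt_bot_iff`), hence `B_f` is smooth for some `f ≠ 0`
(`Algebra.IsSmoothAt.exists_notMem_smooth`), and `φ` factors through `B_f`
(`hasSmoothFactorizations_field_factorsThroughSmooth_of_smooth_away`). The separable case of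
Stacks Tag 07BV, via Tag 037X / Tag 07ND. [cite: StacksProject, Tag 07BV] -/
theorem hasSmoothFactorizations_field_of_formallySmooth (F L : Type) [Field F] [Field L]
    [Algebra F L]
    (h : ∀ B : Subalgebra F L, B.FG → Algebra.FormallySmooth F (FractionRing B)) :
    Literature.AlgebraicGeometry.Resolution.HasSmoothFactorizations F L := by
  intro A _ _ hA φ
  -- the image `B = φ(A) ⊆ L`: finitely generated, hence finitely presented, over the field `F`
  haveI hft : Algebra.FiniteType F φ.range :=
    hA.of_surjective φ.rangeRestrict φ.rangeRestrict_surjective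
  haveI : Algebra.FinitePresentation F φ.range :=
    Algebra.FinitePresentation.of_finiteType.mp hft
  -- generic formal smoothness (hypothesis `h`) is smoothness at the generic point `⊥` of `B`
  haveI : Algebra.IsSmoothAt F (⊥ : Ideal φ.range) :=
    (hasSmoothFactorizations_field_isSmoothAt_bot_iff F φ.range).mpr
      (h φ.range (φ.range.fg_iff_finiteType.mpr hft))
  -- which spreads out to a basic open `D(f)`, `f ≠ 0`, of `Spec B`
  obtain ⟨f, hf, hsmooth⟩ := Algebra.IsSmoothAt.exists_notMem_smooth F (⊥ : Ideal φ.range)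
  have hf0 : (f : L) ≠ 0 := by
    simpa using hf
  exact hasSmoothFactorizations_field_factorsThroughSmooth_of_smooth_away φ f
    (isUnit_iff_ne_zero.mpr hf0) hsmooth

end Summit.ResolutionOfSingularities.ResolutionOfSingularities.Theorems.ValuativeSmoothing
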